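import Summits.CriticalPhenomena.PercolationContinuityZ3.Theorems.PercNearOneGluingNoHeavyLowerTailQ44VertexCoverConeDU
import Summits.CriticalPhenomena.PercolationContinuityZ3.Theorems.PercNearOneGluingNoHeavyLowerTailQ44TTConeUniversal

/-!
# Universality of the terminal-edge cone: the instance for the row `D_U`

Support file for crux `stmt-CriticalPhenomena-4575`, seat `prim-bnk-1` gen 39; memo `run/shared/lean/prim/prim-l12/FROM-prim-bnk-1-gen39-TT-CONE-UNIVERSAL.md`.
Companion of `…Q44TTConeUniversal` (engine and the `W` instance): the 33 rays `raysDU` of the landed vertex-cover certificate `…Q44VertexCoverConeDU` are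
(positive multiples of) images of the kernel under TERMINAL-EDGE words (`raysDU_words`, from 32 one-step identities `raysDU_step` checked by
`native_decide` — computational — along the suffix-closed word table `wordsDU`), hence **`inCone_tact_DU`** (a gadget table that maps the kernel into the
cone maps the whole cone into itself) and **`tactList_botbot_nonneg_DU`**: for every list of component tables `Gs` with `InCone raysDU (tact G kDU)` and every
vertex-cover word `wd`, `0 ≤ (tactList Gs (actWord wd kDU))(⊥,⊥)` (nonnegative two-copy fibre defect of the row `D_U`).  No sorries; standard axioms +
`Lean.ofReduceBool`.
-/

namespace Summit.CriticalPhenomena.PercolationContinuityZ3.Theorems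

namespace VCCone

open Finset TwoCopyMono

/-- The kernel of the row `D_U` (as in `…Q44VertexCoverConeDU`). [this work] -/
def kDU : Ker := fun i j => 2 * indK uTop i j - indK uD i j

/-- Scaling factors: `(gDU k) • raysDU k` is a word image of `kDU`. [this work] -/
def gDU (_k : Fin 33) : ℕ := 1

/-- Head generator (terminal edge `0 Eab … 5 Ecy`) of the word of ray `k` (`k ≥ 1`). [this work] -/
def hdDUTab : Array ℕ :=
  #[0, 0, 1, 2, 3, 4, 5, 0, 0, 0, 0, 1, 1, 1, 1, 2, 2, 2, 3, 3, 4, 0, 0, 0, 0, 1, 1, 1, 1, 1, 2, 2, 2]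

/-- The ray whose word is the tail of the word of ray `k` (`k ≥ 1`). [this work] -/
def prevDUTab : Array ℕ :=
  #[0, 0, 0, 0, 0, 0, 0, 2, 3, 4, 5, 3, 4, 5, 6, 4, 5, 6, 5, 6, 6, 11, 13, 15, 18, 15, 16, 18, 19, 20, 18, 19, 20]

/-- Head generator of ray `k`. [this work] -/
def hdDU (k : Fin 33) : Fin 17 := ⟨(hdDUTab[k.1]!) % 17, Nat.mod_lt _ (by decide)⟩

/-- Tail ray of ray `k`. [this work] -/
def prevDU (k : Fin 33) : Fin 33 := ⟨(prevDUTab[k.1]!) % 33, Nat.mod_lt _ (by decide)⟩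

/-- The terminal-edge word of ray `k` (generator indices `0…5`). [this work] -/
def wordsDUTab : Array (List ℕ) :=
  #[[], [0], [1], [2], [3], [4], [5], [0, 1], [0, 2], [0, 3], [0, 4], [1, 2], [1, 3], [1, 4], [1, 5], [2, 3], [2, 4], [2, 5], [3, 4], [3, 5], [4, 5], [0, 1, 2], [0, 1, 4], [0, 2, 3], [0, 3, 4], [1, 2, 3], [1, 2, 4], [1, 3, 4], [1, 3, 5], [1, 4, 5], [2, 3, 4], [2, 3, 5], [2, 4, 5]]

/-- The word of ray `k`. [this work] -/
def wordsDU (k : Fin 33) : List (Fin 17) :=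
  (wordsDUTab[k.1]!).map fun m => ⟨m % 17, Nat.mod_lt _ (by decide)⟩

/-- All scaling factors are positive. [this work] -/
theorem gDU_pos : ∀ k : Fin 33, 0 < gDU k := by decide

/-- The tail ray has a smaller index. [this work] -/
theorem prevDU_lt : ∀ k : Fin 33, k ≠ 0 → prevDU k < k := by decide

/-- The word table is suffix closed along `prevDU`/`hdDU`. [this work] -/
theorem wordsDU_cons : ∀ k : Fin 33, k ≠ 0 → wordsDU k = hdDU k :: wordsDU (prevDU k) := by decide

/-- The empty word belongs to ray 0. [this work] -/
theorem wordsDU_zero : wordsDU 0 = [] := by decide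

/-- The 32 one-step identities `(g k)·rays k = (g (prev k))·(E_(hd k)·rays (prev k))` (finite check). [this work] -/
theorem raysDU_step : ∀ k : Fin 33, k ≠ 0 → ∀ x y : Fin 15,
    (gDU k : ℤ) * raysDU k x y = (gDU (prevDU k) : ℤ) * act (hdDU k) (raysDU (prevDU k)) x y := by
  native_decide

/-- **The rays of the `D_U` certificate are terminal-edge word images of the kernel** (up to the factors `gDU`). [this work] -/
theorem raysDU_words : ∀ k : Fin 33, ∀ x y : Fin 15, (gDU k : ℤ) * raysDU k x y = actWord (wordsDU k) kDU x y := by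
  suffices h : ∀ m : ℕ, ∀ k : Fin 33, k.1 = m → ∀ x y : Fin 15,
      (gDU k : ℤ) * raysDU k x y = actWord (wordsDU k) kDU x y from fun k => h k.1 k rfl
  intro m
  induction m using Nat.strong_induction_on with
  | _ m ih =>
    intro k hk x y
    by_cases h0 : k = 0
    · subst h0
      rw [wordsDU_zero]
      show (gDU 0 : ℤ) * raysDU 0 x y = kDU x y
      rw [raysDU_zero x y]
      simp [gDU, kDU]
    · rw [raysDU_step k h0 x y, wordsDU_cons k h0]
      have hlt : (prevDU k).1 < m := hk ▸ prevDU_lt k h0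
      have ihk : ∀ x y, (gDU (prevDU k) : ℤ) * raysDU (prevDU k) x y = actWord (wordsDU (prevDU k)) kDU x y :=
        ih _ hlt (prevDU k) rfl
      have hfun : (fun i j => (gDU (prevDU k) : ℤ) * raysDU (prevDU k) i j) = actWord (wordsDU (prevDU k)) kDU := by
        funext i j; exact ihk i j
      rw [← act_smul, hfun]
      rfl

/-- The kernel is in its cone. [this work] -/
theorem inCone_kDU : InCone raysDU kDU := inCone_DU

/-- **Universality for `D_U`.**  A table that maps `kDU` into the cone maps the whole cone into itself. [this work] -/
theorem inCone_tact_DU {G : Table} (hG : InCone raysDU (tact G kDU)) {M : Ker} (hM : InCone raysDU M) :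
    InCone raysDU (tact G M) :=
  inCone_tact_of_base raysDU invariant_DU wordsDU gDU gDU_pos raysDU_words hG hM

/-- **Row `D_U` (fibre form) on every graph built from certified components**: for every list of gadget tables `Gs` with
`InCone raysDU (tact G kDU)` and every vertex-cover word `wd`, `0 ≤ (tactList Gs (actWord wd kDU))(⊥,⊥)`. [this work] -/
theorem tactList_botbot_nonneg_DU (Gs : List Table) (hGs : ∀ G ∈ Gs, InCone raysDU (tact G kDU))
    (wd : List (Fin 17)) : 0 ≤ tactList Gs (actWord wd kDU) 0 0 :=
  tactList_botbot_nonneg_of_base raysDU invariant_DU raysDU_botbot inCone_kDU wordsDU gDU gDU_pos raysDU_words Gs hGs wd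

end VCCone

end Summit.CriticalPhenomena.PercolationContinuityZ3.Theorems
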